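import Literature.Barriers.Parity.SiegelZeroQuadraticPolynomialsTheorem4Prep
import Literature.NumberTheory.LFunctions.LOneTruncatedEulerProduct
import Literature.NumberTheory.LFunctions.PrimitiveQuadraticCharacter
import HarnessLib

/-!
# Granville–Mollin 2000, Theorem 1 (the uniform upper bound `π_f(N) ≪ L(1,(d/·))⁻¹ N/log N`
# for `N > |d|^τ`), PROVED: `GranvilleMollin2000_thm1_holds`

Topic `Literature/Barriers/Parity`, companion ("Proofs"-type, theorems only, everything PROVED) of
the catalogue entry `SiegelZeroQuadraticPolynomials.lean` (Granville–Mollin, *Rabinowitsch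
revisited*, Acta Arith. 96 (2000) 139–153). It discharges the named fact
`Literature.Barriers.Parity.GranvilleMollin2000_thm1` — the source's **Theorem 1**, (1.4), for the
monic family `f_d = x² + x + (1 − d)/4`, `d` a negative fundamental discriminant `≡ 1 (mod 4)`:
"Fix `τ > 0`. Uniformly for all quadratic polynomials `f(x) = ax² + bx + c`, if
`N > |d|^τ + log|a|` then `π_f(N) ≪ L(1, (d/·))⁻¹ (a/φ(a)) · N/log N`" (p. 141; here `a = 1`).

## The printed proof and the proof given here

The source (pp. 141, 148–150) combines three ingredients:
* (1.2) "by the fundamental lemma of the sieve … uniformly `π_f(N) ≪ ∏_{p ≤ N}(1 − ω(p)/p) N`";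
* (5.1) `∏_{p ≤ N}(1 − ω(p)/p) ≍ (1/log N)(a/φ(a)) ∏_{p ≤ N}(1 − (d/p)/p)`, from `ω(p) = 1 + (d/p)`
  (`p ∤ a`);
* §5B (5.3) / §5C (5.4)–(5.5): `∏_{p ≤ x}(1 − (d/p)/p) ≪_τ L(1, (d/·))⁻¹` for `x > |d|^τ`, which
  the paper derives from the explicit formula (3.1) and Bombieri's log-free zero-density estimate
  with the Deuring–Heilbronn factor (3.2)–(3.3), separately with and without a Siegel zero.

All three are available in the tree, PROVED, and this file only assembles them:
* the sieve step is the tree's Fundamental Lemma for polynomial sequences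
  (`Literature.NumberTheory.Sieve.card_apIndex_coprime_le`, `PolynomialValuesSieveBounds.lean`,
  dimension `2`: `ω(2) ≤ 1`, `ω(p) ≤ 2`) together with the decomposition
  `π_{f_d}(N) ≤ #{1 ≤ n ≤ N : (f_d(n), P(z)) = 1} + √z + 1`
  (`Literature.Barriers.Parity.rabinowitsch_polyPrimeCount_le`), at `z = D = M = ⌊N^{1/4}⌋`;
* `ω_{f_d}(p) = 1 + (p/q)` (`q = |d|`; `Literature.Barriers.Parity.polyRootCountMod_rabinowitschPoly`,
  quadratic reciprocity) and "the primitive quadratic character mod `q` is the Jacobi symbol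
  `(·/q)`" (`Literature.NumberTheory.LFunctions.PrimitiveQuadratic.apply_natCast_eq_jacobiSym`)
  give `ω(p) = 1 + χ(p)`, whence `1 − ω(p)/p ≤ (1 − 1/p)(1 − χ(p)/p)(1 + 4/p²)` and, with Mertens'
  formula (`Literature.NumberTheory.LFunctions.Mertens.abs_prod_one_sub_inv_mul_log_sub_one_le`),
  `V(M) = ∏_{p < M}(1 − ω(p)/p) ≤ 3e⁴/log(M − 1) · ∏_{p < M}(1 − χ(p)/p)`;
* the analytic input is the tree's ONE-SIDED truncated Euler product bound
  `Literature.NumberTheory.LFunctions.DirichletLOne.exists_prod_one_sub_re_div_le`: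
  `∏_{p < M}(1 − Re χ(p)/p) ≤ e^{C/τ'}/|L(1, χ)|` for `M ≥ e⁸`, `M ≥ q^{τ'}`, `0 < τ' ≤ 1`
  (from `Re L'/L(σ, χ) ≥ −E log 4q` for `σ > 1`, Montgomery–Vaughan Lemma 11.1; the possible
  exceptional zero only helps, exactly as in the source's §5C). With Mertens' lower bound
  `∏_{p ≤ X}(1 − 1/p) ≥ e^{−5}/log X` it also yields `|L(1, χ)| ≤ e^{C/τ' + 5} log M`, which
  controls the sieve remainder `M e⁸ log² M + √M + 1` and the trivial cases.

Parameters: `τ' = min(τ, 1)/8`, `M = ⌊N^{1/4}⌋` (so `M − 1 ≥ N^{1/8} ≥ q^{τ'}` and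
`log(M − 1) ≥ log N / 8` once `N ≥ e^{104}`); for `N < e^{104}` the modulus is bounded
(`q < N^{1/τ} < e^{104/τ}`) and the crude bound `|L(1, χ)| ≤ q ζ(5/4)`
(`Literature.NumberTheory.LFunctions.DirichletZFR.norm_LFunction_le_of_re_ge`) with
`π_f(N) ≤ N + 1` suffices; for `d ≡ 1 (mod 8)` (`q ≡ 7 (mod 8)`) every value of `f_d` is even, so
`π_{f_d}(N) ≤ 1` (`polyPrimeCount_rabinowitsch_le_one`), the case of a fixed prime divisor in which
(1.2) is to be read with this convention.

[cite: GranvilleMollin2000, Theorem 1 (1.4), (1.2), (5.1), §5B (5.3), §5C (5.4)–(5.5)]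
-/

noncomputable section

open Finset Real Polynomial
open Literature.NumberTheory.Sieve

namespace Literature.Barriers.Parity

/-! ### Elementary pieces -/

/-- `π_f(N) ≤ N + 1` (the count is over `n = 0, 1, …, N`). [folklore] -/
theorem polyPrimeCount_single_le_succ (f : ℤ[X]) (N : ℕ) : polyPrimeCount ![f] N ≤ N + 1 := by
  unfold polyPrimeCount
  calc _ ≤ #(range (N + 1)) := Finset.card_le_card (fun x hx => by
          simp only [Finset.mem_filter] at hx; exact hx.1)
    _ = N + 1 := Finset.card_range _

/-- **The fixed-prime-divisor case**: for `q ≡ 7 (mod 8)` (`d = −q ≡ 1 (mod 8)`) every value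
`f_d(n) = n(n + 1) + (1 + q)/4` is even, so at most one of them (`f_{−7}(0) = 2`) is prime:
`π_{f_d}(N) ≤ 1`. [cite: GranvilleMollin2000, Theorem 1 (the case `ω(2) = 2`)] -/
theorem polyPrimeCount_rabinowitsch_le_one {d : ℤ} {q : ℕ} (hdq : d = -(q : ℤ)) (hq8 : q % 8 = 7)
    (N : ℕ) : polyPrimeCount ![rabinowitschPoly d] N ≤ 1 := by
  by_cases hq15 : 15 ≤ q
  · rw [polyPrimeCount_rabinowitsch_eq_zero hdq hq8 hq15]; exact zero_le_one
  · have hq7 : q = 7 := by omega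
    subst hq7
    have hpos := rabinowitsch_eval_pos hdq (by norm_num : 3 ≤ 7)
    rw [polyPrimeCount_single_eq_card _ hpos]
    refine (Finset.card_le_card (t := {0}) ?_).trans (by simp)
    intro n hn
    rw [Finset.mem_filter] at hn
    rw [Finset.mem_singleton]
    by_contra hn0
    have h := hn.2
    rw [rabinowitsch_eval_eq hdq] at h
    obtain ⟨m, hm⟩ := Int.even_mul_succ_self (n : ℤ)
    have hmn : (n : ℤ) ^ 2 + n = m + m := by rw [← hm]; ring
    have hA : (1 + ((7 : ℕ) : ℤ)) / 4 = 2 := by norm_num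
    have hval : (n : ℤ) ^ 2 + n + (1 + ((7 : ℕ) : ℤ)) / 4 = 2 * (m + 1) := by rw [hA]; linarith
    rw [hval, Int.natAbs_mul] at h
    refine Nat.not_prime_mul (by decide) ?_ h
    have hn1 : (1 : ℤ) ≤ n := by exact_mod_cast Nat.one_le_iff_ne_zero.mpr hn0
    have hm1 : (1 : ℤ) ≤ m := by nlinarith
    omega

/-- The Euler-factor comparison behind (5.1): for `p ≥ 2` and `|c| ≤ 1`,
`1 − (1 + c)/p ≤ (1 − 1/p)(1 − c/p)(1 + 4/p²)` (the difference is
`p⁻² (4(1 − 1/p) + c(1 − 2/p)²) ≥ 0`). [cite: GranvilleMollin2000, §5 (5.1)] -/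
theorem one_sub_one_add_div_le {p c : ℝ} (hp : 2 ≤ p) (hc : |c| ≤ 1) :
    1 - (1 + c) / p ≤ (1 - 1 / p) * (1 - c / p) * (1 + 4 / p ^ 2) := by
  rw [abs_le] at hc
  have hp0 : 0 < p := by linarith
  set x : ℝ := 1 / p with hx
  have hx0 : 0 < x := by positivity
  have hx2 : x ≤ 1 / 2 := by
    rw [hx]; exact one_div_le_one_div_of_le (by norm_num) hp
  have e1 : (1 + c) / p = (1 + c) * x := by rw [hx]; field_simp
  have e2 : c / p = c * x := by rw [hx]; field_simp
  have e3 : 4 / p ^ 2 = 4 * x ^ 2 := by rw [hx]; field_simp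
  rw [e1, e2, e3]
  have key : (1 - x) * (1 - c * x) * (1 + 4 * x ^ 2) - (1 - (1 + c) * x) =
      x ^ 2 * (4 * (1 - x) + c * (1 - 2 * x) ^ 2) := by ring
  have h1 : 0 ≤ (1 - 2 * x) ^ 2 := sq_nonneg _
  have h2 : (1 - 2 * x) ^ 2 ≤ 1 := by nlinarith
  have h3 : 0 ≤ 4 * (1 - x) + c * (1 - 2 * x) ^ 2 := by nlinarith
  nlinarith [mul_nonneg (sq_nonneg x) h3]

/-- `∏_{p < M} (1 + 4/p²) ≤ e⁴` (`∑_p 1/p² ≤ ∑_p 1/(p(p−1)) ≤ 1`, the tree's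
`MertensBound.sum_inv_prime_mul_pred_le_one`). [folklore] -/
theorem prod_one_add_four_div_sq_le (M : ℕ) :
    ∏ p ∈ Nat.primesBelow M, (1 + 4 / (p : ℝ) ^ 2) ≤ Real.exp 4 := by
  have h1 : ∏ p ∈ Nat.primesBelow M, (1 + 4 / (p : ℝ) ^ 2) ≤
      Real.exp (∑ p ∈ Nat.primesBelow M, 4 / (p : ℝ) ^ 2) := by
    rw [Real.exp_sum]
    exact Finset.prod_le_prod (fun p _ => by positivity)
      (fun p _ => by linarith [Real.add_one_le_exp (4 / (p : ℝ) ^ 2)])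
  refine h1.trans (Real.exp_le_exp.mpr ?_)
  have hsub : Nat.primesBelow M ⊆ Nat.primesLE M := fun p hp => by
    rw [Nat.mem_primesBelow] at hp
    exact Nat.mem_primesLE.mpr ⟨hp.1.le, hp.2⟩
  have hpt : ∀ p ∈ Nat.primesLE M, 4 / (p : ℝ) ^ 2 ≤ 4 * (1 / ((p : ℝ) * (p - 1))) := by
    intro p hp
    have hp2 : (2 : ℝ) ≤ p := by exact_mod_cast (Nat.prime_of_mem_primesLE hp).two_le
    rw [show (4 : ℝ) / (p : ℝ) ^ 2 = 4 * (1 / (p : ℝ) ^ 2) by ring]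
    refine mul_le_mul_of_nonneg_left ?_ (by norm_num)
    refine one_div_le_one_div_of_le (mul_pos (by linarith) (by linarith)) ?_
    nlinarith
  calc ∑ p ∈ Nat.primesBelow M, 4 / (p : ℝ) ^ 2
      ≤ ∑ p ∈ Nat.primesLE M, 4 / (p : ℝ) ^ 2 :=
        Finset.sum_le_sum_of_subset_of_nonneg hsub (fun p _ _ => by positivity)
    _ ≤ ∑ p ∈ Nat.primesLE M, 4 * (1 / ((p : ℝ) * (p - 1))) := Finset.sum_le_sum hpt
    _ = 4 * ∑ p ∈ Nat.primesLE M, 1 / ((p : ℝ) * (p - 1)) := by rw [Finset.mul_sum]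
    _ ≤ 4 * 1 := mul_le_mul_of_nonneg_left
        (Literature.NumberTheory.LFunctions.MertensBound.sum_inv_prime_mul_pred_le_one M) (by norm_num)
    _ = 4 := mul_one _

/-- **Mertens, upper bound**: `∏_{p ≤ X} (1 − 1/p) ≤ 3/log X` for `X ≥ e^{12}` (from the tree's
Mertens formula `|∏_{p ≤ x}(1 − 1/p) e^γ log x − 1| ≤ 24/log x`). [folklore] -/
theorem prod_primesLE_one_sub_inv_le {X : ℕ} (hX : Real.exp 12 ≤ (X : ℝ)) :
    ∏ p ∈ Nat.primesLE X, (1 - 1 / (p : ℝ)) ≤ 3 / Real.log X := by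
  have hX0 : (0 : ℝ) < X := lt_of_lt_of_le (Real.exp_pos _) hX
  have hlog : 12 ≤ Real.log X := by rw [Real.le_log_iff_exp_le hX0]; exact hX
  have hX2 : (2 : ℝ) ≤ X := le_trans (by have := Real.add_one_le_exp (12 : ℝ); linarith) hX
  have h := Literature.NumberTheory.LFunctions.Mertens.abs_prod_one_sub_inv_mul_log_sub_one_le hX2 hlog
  rw [Nat.floor_natCast] at h
  have hγ : 1 ≤ Real.exp Real.eulerMascheroniConstant :=
    Real.one_le_exp (le_of_lt (lt_trans (by norm_num) Real.one_half_lt_eulerMascheroniConstant))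
  set P : ℝ := ∏ p ∈ Nat.primesLE X, (1 - (p : ℝ)⁻¹) with hP
  have hPle : P * (Real.exp Real.eulerMascheroniConstant * Real.log X) ≤ 1 + 24 / Real.log X := by
    linarith [(abs_le.mp h).2]
  have h24 : 24 / Real.log X ≤ 2 := by rw [div_le_iff₀ (by linarith)]; linarith
  have hprod_eq : ∏ p ∈ Nat.primesLE X, (1 - 1 / (p : ℝ)) = P := by simp only [one_div, hP]
  have hPnn : 0 ≤ P := by
    refine Finset.prod_nonneg fun p hp => ?_
    have hp1 : (1 : ℝ) ≤ p := by exact_mod_cast (Nat.prime_of_mem_primesLE hp).one_lt.le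
    exact sub_nonneg.mpr (inv_le_one_of_one_le₀ hp1)
  rw [hprod_eq, le_div_iff₀ (by linarith)]
  calc P * Real.log X ≤ P * (Real.exp Real.eulerMascheroniConstant * Real.log X) := by
        refine mul_le_mul_of_nonneg_left ?_ hPnn
        nlinarith
    _ ≤ 3 := by linarith

/-- **`|L(1, χ)| ≪_τ log M` from the one-sided truncated Euler product bound**: if
`∏_{p < M}(1 − Re χ(p)/p) ≤ B/|L(1, χ)|` for some `M ≥ 3` and `χ ≠ χ₀`, then
`|L(1, χ)| ≤ B e⁵ log M`, because `∏_{p < M}(1 − Re χ(p)/p) ≥ ∏_{p ≤ M−1}(1 − 1/p) ≥ e^{−5}/log(M−1)`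
(the tree's `MertensBound.exp_neg_div_log_le_prod_one_sub_inv`). [folklore] -/
theorem norm_LFunction_one_le_of_prod_le {q : ℕ} [NeZero q] (χ : DirichletCharacter ℂ q)
    (hχ : χ ≠ 1) {M : ℕ} (hM : 3 ≤ M) {B : ℝ}
    (h : ∏ p ∈ Nat.primesBelow M, (1 - (χ p).re / p) ≤ B / ‖χ.LFunction 1‖) :
    ‖χ.LFunction 1‖ ≤ B * Real.exp 5 * Real.log M := by
  have hL0 : 0 < ‖χ.LFunction 1‖ := norm_pos_iff.mpr (DirichletCharacter.LFunction_apply_one_ne_zero hχ)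
  set P : ℝ := ∏ p ∈ Nat.primesBelow M, (1 - (χ p).re / p) with hPdef
  -- `P ≥ ∏_{p ≤ M-1} (1 - 1/p) ≥ e^{-5}/log(M-1) ≥ e^{-5}/log M`
  have hM1 : 1 ≤ M := by omega
  have hM2 : 2 ≤ M - 1 := by omega
  have hMR : (3 : ℝ) ≤ M := by exact_mod_cast hM
  have hcast : ((M - 1 : ℕ) : ℝ) = (M : ℝ) - 1 := by
    rw [Nat.cast_sub hM1]; simp
  have hlogM1 : 0 < Real.log ((M - 1 : ℕ) : ℝ) := by
    rw [hcast]; exact Real.log_pos (by linarith)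
  have hlogM : Real.log ((M - 1 : ℕ) : ℝ) ≤ Real.log M := by
    rw [hcast]; exact Real.log_le_log (by linarith) (by linarith)
  have hlogMpos : 0 < Real.log M := lt_of_lt_of_le hlogM1 hlogM
  have hP1 : ∏ p ∈ Nat.primesLE (M - 1), (1 - 1 / (p : ℝ)) ≤ P := by
    rw [hPdef, Nat.primesBelow_eq_primesLE_sub_one M]
    refine Finset.prod_le_prod (fun p hp => ?_) (fun p hp => ?_)
    · have hp1 : (1 : ℝ) ≤ p := by exact_mod_cast (Nat.prime_of_mem_primesLE hp).one_lt.le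
      rw [sub_nonneg, div_le_one (by linarith)]; exact hp1
    · have hp0 : (0 : ℝ) < p := by exact_mod_cast (Nat.prime_of_mem_primesLE hp).pos
      have hre : (χ p).re ≤ 1 := (Complex.re_le_norm _).trans (DirichletCharacter.norm_le_one χ _)
      have : (χ p).re / p ≤ 1 / p := div_le_div_of_nonneg_right hre hp0.le
      linarith
  have hP2 : Real.exp (-5) / Real.log M ≤ P := by
    calc Real.exp (-5) / Real.log M ≤ Real.exp (-5) / Real.log ((M - 1 : ℕ) : ℝ) :=
          div_le_div_of_nonneg_left (Real.exp_pos _).le hlogM1 hlogM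
      _ ≤ ∏ p ∈ Nat.primesLE (M - 1), (1 - 1 / (p : ℝ)) :=
          Literature.NumberTheory.LFunctions.MertensBound.exp_neg_div_log_le_prod_one_sub_inv (M - 1) hM2
      _ ≤ P := hP1
  have hlow : 0 < Real.exp (-5) / Real.log M := div_pos (Real.exp_pos _) hlogMpos
  -- `‖L‖ P ≤ B`
  have h1 : ‖χ.LFunction 1‖ * P ≤ B := by
    have := h
    rw [le_div_iff₀ hL0] at this
    linarith [mul_comm P ‖χ.LFunction 1‖]
  have h2 : ‖χ.LFunction 1‖ * (Real.exp (-5) / Real.log M) ≤ B := by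
    calc ‖χ.LFunction 1‖ * (Real.exp (-5) / Real.log M) ≤ ‖χ.LFunction 1‖ * P :=
          mul_le_mul_of_nonneg_left hP2 hL0.le
      _ ≤ B := h1
  rw [← le_div_iff₀ hlow] at h2
  calc ‖χ.LFunction 1‖ ≤ B / (Real.exp (-5) / Real.log M) := h2
    _ = B * Real.exp 5 * Real.log M := by
        rw [Real.exp_neg]; field_simp

/-- The values of `f_d`, `d = −q`, on `1 ≤ n ≤ N` are positive and `≤ (N + q + 1)²` (the size
parameter of the sieve). [folklore] -/
theorem rabinowitsch_eval_le_sq {d : ℤ} {q : ℕ} (hdq : d = -(q : ℤ)) {N n : ℕ} (hn : n ≤ N) :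
    (((rabinowitschPoly d).eval (n : ℤ) : ℤ) : ℝ) ≤ ((N : ℝ) + q + 1) ^ 2 := by
  have h : (rabinowitschPoly d).eval (n : ℤ) ≤ ((N : ℤ) + q + 1) ^ 2 := by
    rw [rabinowitsch_eval_eq hdq]
    have h1 : (1 + (q : ℤ)) / 4 ≤ 1 + (q : ℤ) := Int.ediv_le_self _ (by positivity)
    have hn' : (n : ℤ) ≤ N := by exact_mod_cast hn
    have hn0 : (0 : ℤ) ≤ n := by positivity
    have hq0 : (0 : ℤ) ≤ q := by positivity
    have hsq : (n : ℤ) ^ 2 ≤ (N : ℤ) ^ 2 := pow_le_pow_left₀ hn0 hn' 2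
    nlinarith
  exact_mod_cast h

/-! ### Theorem 1 -/

set_option maxHeartbeats 800000 in
/-- **Granville–Mollin 2000, Theorem 1, PROVED** (the named fact
`Literature.Barriers.Parity.GranvilleMollin2000_thm1`): for every `τ > 0` there is `K` such that for
every negative fundamental `d ≡ 1 (mod 4)`, the primitive quadratic character `χ` mod `q = |d|`
(`= (d/·)`), and every `N ≥ 2` with `N > |d|^τ`,
`π_{f_d}(N) ≤ K · |L(1, χ)|⁻¹ · N/log N`, `f_d = x² + x + (1 − d)/4`.
Assembly of the tree's Fundamental Lemma for polynomial sequences, `ω_{f_d}(p) = 1 + χ(p)`,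
Mertens' formula and the one-sided truncated Euler product bound
`∏_{p<M}(1 − χ(p)/p) ≪_τ L(1, χ)⁻¹` (`M ≥ q^{τ'}`), see the module docstring.
[cite: GranvilleMollin2000, Theorem 1 (1.4), with (1.2), (5.1), (5.3)–(5.5)] -/
theorem GranvilleMollin2000_thm1_holds : GranvilleMollin2000_thm1 := by
  intro τ hτ
  -- absolute constants
  obtain ⟨C, hC0, hC⟩ := Literature.NumberTheory.LFunctions.DirichletLOne.exists_prod_one_sub_re_div_le
  set Z : ℝ := ∑' n : ℕ, ((n + 1 : ℕ) : ℝ) ^ (-(5 / 4 : ℝ)) with hZ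
  have hZ1 : 1 ≤ Z := Literature.NumberTheory.LFunctions.DirichletZFR.one_le_tsum_rpow
  set Cω : ℝ := SieveSequence.flConst 2 (2 * Real.exp (17 + 12 / Real.log 2)) with hCωdef
  have hCω : 0 < Cω := SieveSequence.flConst_pos (by norm_num) (by positivity)
  -- the exponent `τ' = min(τ,1)/8`
  set τ' : ℝ := min τ 1 / 8 with hτ'def
  have hmin0 : 0 < min τ 1 := lt_min hτ one_pos
  have hτ'0 : 0 < τ' := by rw [hτ'def]; positivity
  have hτ'1 : τ' ≤ 1 := by
    rw [hτ'def]; have := min_le_right τ 1; linarith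
  have hτ'τ : τ' / τ ≤ 1 / 8 := by
    rw [hτ'def, div_div, div_le_div_iff₀ (by positivity) (by norm_num)]
    have := min_le_left τ 1
    nlinarith
  have hτ'τ0 : 0 ≤ τ' / τ := by positivity
  set A : ℝ := Real.exp (C / τ') with hAdef
  have hA0 : 0 < A := Real.exp_pos _
  -- the constant `K`
  set Ksmall : ℝ := 2 * 104 * (Real.exp (104 / τ) * Z) with hKsmall
  set KB : ℝ := 256 * (A * Real.exp 5) with hKB
  set Kmain : ℝ := (1 + Cω) * 24 * Real.exp 4 * A with hKmain
  set Kerr : ℝ := (Real.exp 8 + 2) * (A * Real.exp 5) * 16 ^ 4 with hKerr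
  have hKsmall0 : 0 ≤ Ksmall := by positivity
  have hKB0 : 0 ≤ KB := by positivity
  have hKmain0 : 0 ≤ Kmain := by positivity
  have hKerr0 : 0 ≤ Kerr := by positivity
  clear_value Z τ' A Cω Ksmall KB Kmain Kerr
  refine ⟨Ksmall + KB + Kmain + Kerr, ?_⟩
  intro d hd q _ hq χ hprim hquad N hN2 hNτ
  obtain ⟨hd0, hdsq, hd4⟩ := hd
  -- `d = -q`, `q ≡ 3 (mod 4)` squarefree, `χ ≠ 1`
  have hdq : d = -(q : ℤ) := by rw [abs_of_neg hd0] at hq; omega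
  have hq4 : q % 4 = 3 := by omega
  have hq3 : 3 ≤ q := by omega
  have hqnat : d.natAbs = q := by omega
  have hqsq : Squarefree q := by
    have := Int.squarefree_natAbs.mpr hdsq
    rwa [hqnat] at this
  have hqodd : Odd q := Nat.odd_iff.mpr (by omega)
  have hχ1 : χ ≠ 1 := by
    intro h
    rw [h, DirichletCharacter.isPrimitive_def, DirichletCharacter.conductor_one] at hprim
    omega
  have hdR : |(d : ℝ)| = q := by
    rw [hdq]; push_cast; rw [abs_neg]; exact abs_of_nonneg (Nat.cast_nonneg q)
  rw [hdR] at hNτ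
  -- basic facts on `N`
  have hN2R : (2 : ℝ) ≤ N := by exact_mod_cast hN2
  have hN1 : (1 : ℝ) ≤ N := by linarith
  have hNpos : (0 : ℝ) < N := by linarith
  have hlogN : 0 < Real.log N := Real.log_pos (by linarith)
  have hq0 : (0 : ℝ) ≤ q := Nat.cast_nonneg q
  have hqτ0 : 0 ≤ (q : ℝ) ^ τ := Real.rpow_nonneg hq0 τ
  -- `L(1, χ) ≠ 0`
  have hL0 : 0 < ‖χ.LFunction 1‖ := norm_pos_iff.mpr (DirichletCharacter.LFunction_apply_one_ne_zero hχ1)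
  -- the target quantity `T = ‖L‖⁻¹ N / log N`
  rw [mul_assoc]
  set T : ℝ := ‖χ.LFunction 1‖⁻¹ * ((N : ℝ) / Real.log N) with hT
  have hT0 : 0 ≤ T := by positivity
  clear_value T
  -- to show `X ≤ Kc T` it suffices that `X ‖L‖ log N ≤ Kc N`
  have key : ∀ {X Kc : ℝ}, X * (‖χ.LFunction 1‖ * Real.log N) ≤ Kc * N → X ≤ Kc * T := by
    intro X Kc h
    rw [hT, show Kc * (‖χ.LFunction 1‖⁻¹ * ((N : ℝ) / Real.log N)) =
      Kc * N / (‖χ.LFunction 1‖ * Real.log N) by field_simp, le_div_iff₀ (by positivity)]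
    exact h
  -- the trivial bound `π ≤ N + 1 ≤ 2N`
  have hπN : (polyPrimeCount ![rabinowitschPoly d] N : ℝ) ≤ 2 * N := by
    have : (polyPrimeCount ![rabinowitschPoly d] N : ℝ) ≤ N + 1 := by
      exact_mod_cast polyPrimeCount_single_le_succ (rabinowitschPoly d) N
    linarith
  have hπ0 : (0 : ℝ) ≤ polyPrimeCount ![rabinowitschPoly d] N := Nat.cast_nonneg _
  by_cases hsmall : (N : ℝ) < Real.exp 104
  · /- SMALL `N`: `q < N^{1/τ} < e^{104/τ}`, `‖L(1,χ)‖ ≤ q Z`, `π ≤ 2N`. -/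
    have hqlt : (q : ℝ) < Real.exp (104 / τ) := by
      have h1 : (q : ℝ) = ((q : ℝ) ^ τ) ^ (1 / τ) := by
        rw [← Real.rpow_mul hq0, mul_one_div_cancel hτ.ne', Real.rpow_one]
      have h2 : ((q : ℝ) ^ τ) ^ (1 / τ) < (N : ℝ) ^ (1 / τ) :=
        Real.rpow_lt_rpow hqτ0 hNτ (by positivity)
      have h3 : (N : ℝ) ^ (1 / τ) < (Real.exp 104) ^ (1 / τ) :=
        Real.rpow_lt_rpow hNpos.le hsmall (by positivity)
      have h4 : (Real.exp 104) ^ (1 / τ) = Real.exp (104 / τ) := by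
        rw [← Real.exp_mul, mul_one_div]
      rw [h1, ← h4]; exact h2.trans h3
    have hLq : ‖χ.LFunction 1‖ ≤ q * Z := by
      have := Literature.NumberTheory.LFunctions.DirichletZFR.norm_LFunction_le_of_re_ge χ hχ1
        (s := 1) (by norm_num)
      rw [hZ]; simpa using this
    have hLsmall : ‖χ.LFunction 1‖ ≤ Real.exp (104 / τ) * Z := by
      refine hLq.trans (mul_le_mul_of_nonneg_right hqlt.le (by linarith))
    have hlog104 : Real.log N ≤ 104 := by
      have := Real.log_lt_log hNpos hsmall
      rw [Real.log_exp] at this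
      exact this.le
    have hstep : (polyPrimeCount ![rabinowitschPoly d] N : ℝ) ≤ Ksmall * T := by
      refine key ?_
      calc (polyPrimeCount ![rabinowitschPoly d] N : ℝ) * (‖χ.LFunction 1‖ * Real.log N)
          ≤ (2 * N) * (Real.exp (104 / τ) * Z * 104) := by
            refine mul_le_mul hπN ?_ (by positivity) (by positivity)
            exact mul_le_mul hLsmall hlog104 hlogN.le (by positivity)
        _ = Ksmall * N := by rw [hKsmall]; ring
    calc (polyPrimeCount ![rabinowitschPoly d] N : ℝ) ≤ Ksmall * T := hstep
      _ ≤ (Ksmall + KB + Kmain + Kerr) * T := by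
          refine mul_le_mul_of_nonneg_right ?_ hT0; linarith
  · /- LARGE `N ≥ e^{104}`. -/
    replace hsmall : Real.exp 104 ≤ (N : ℝ) := not_lt.mp hsmall
    -- `u = N^{1/8} ≥ e^{13}` and the power identities needed later
    set u : ℝ := (N : ℝ) ^ ((1 : ℝ) / 8) with hu
    have hu13 : Real.exp 13 ≤ u := by
      have : Real.exp 13 = (Real.exp 104) ^ ((1 : ℝ) / 8) := by
        rw [← Real.exp_mul]; norm_num
      rw [this, hu]
      exact Real.rpow_le_rpow (Real.exp_pos _).le hsmall (by norm_num)
    have hN14 : (N : ℝ) ^ ((1 : ℝ) / 4) = u ^ 2 := by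
      rw [hu, ← Real.rpow_natCast, ← Real.rpow_mul hNpos.le]; norm_num
    have hN12 : (N : ℝ) ^ ((1 : ℝ) / 2) = u ^ 4 := by
      rw [hu, ← Real.rpow_natCast, ← Real.rpow_mul hNpos.le]; norm_num
    have hN16 : ((N : ℝ) ^ ((1 : ℝ) / 16)) ^ 2 = u := by
      rw [hu, ← Real.rpow_natCast, ← Real.rpow_mul hNpos.le]; norm_num
    have hlogu : Real.log u = Real.log N / 8 := by
      rw [hu, Real.log_rpow hNpos]; ring
    have huN : u ≤ N := by
      rw [hu]
      calc (N : ℝ) ^ ((1 : ℝ) / 8) ≤ (N : ℝ) ^ (1 : ℝ) := Real.rpow_le_rpow_of_exponent_le hN1 (by norm_num)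
        _ = N := Real.rpow_one _
    have hNu : (N : ℝ) ^ (τ' / τ) ≤ u := by
      rw [hu]; exact Real.rpow_le_rpow_of_exponent_le hN1 hτ'τ
    clear_value u
    have he13 : (16 : ℝ) ≤ Real.exp 13 := by
      have h16 := Literature.NumberTheory.LFunctions.DirichletLOne.sixteen_le_exp_eight
      exact h16.trans (Real.exp_le_exp.mpr (by norm_num))
    have hu2 : (2 : ℝ) ≤ u := by linarith
    have hu0 : 0 < u := by linarith
    have hu4N : u ^ 4 ≤ N := by
      rw [← hN12]
      calc (N : ℝ) ^ ((1 : ℝ) / 2) ≤ (N : ℝ) ^ (1 : ℝ) := Real.rpow_le_rpow_of_exponent_le hN1 (by norm_num)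
        _ = N := Real.rpow_one _
    -- `M = ⌊N^{1/4}⌋`, `M - 1 ≥ u`
    set M : ℕ := ⌊(N : ℝ) ^ ((1 : ℝ) / 4)⌋₊ with hMdef
    have hMle : (M : ℝ) ≤ u ^ 2 := by rw [← hN14]; exact Nat.floor_le (by positivity)
    have hMgt : u ^ 2 < (M : ℝ) + 1 := by rw [← hN14]; exact Nat.lt_floor_add_one _
    clear_value M
    have huM : u ≤ (M : ℝ) - 1 := by
      have h0 : 0 ≤ (u - 2) * (u + 1) := mul_nonneg (by linarith) (by linarith)
      have h0' : (u - 2) * (u + 1) = u ^ 2 - u - 2 := by ring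
      linarith
    have hMu : u ≤ (M : ℝ) := by linarith
    have hM3R : (3 : ℝ) ≤ M := by linarith
    have hM3 : 3 ≤ M := by exact_mod_cast hM3R
    have hM1 : 1 ≤ M := by omega
    have hM0 : (0 : ℝ) < M := by linarith
    have hMN : (M : ℝ) ≤ N := by
      calc (M : ℝ) ≤ u ^ 2 := hMle
        _ = (N : ℝ) ^ ((1 : ℝ) / 4) := hN14.symm
        _ ≤ (N : ℝ) ^ (1 : ℝ) := Real.rpow_le_rpow_of_exponent_le hN1 (by norm_num)
        _ = N := Real.rpow_one _
    have hlogMN : Real.log M ≤ Real.log N := Real.log_le_log hM0 hMN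
    have hM8 : Real.exp 8 ≤ (M : ℝ) :=
      le_trans (Real.exp_le_exp.mpr (by norm_num)) (hu13.trans hMu)
    -- `q^{τ'} ≤ u ≤ M`
    have hqτ' : (q : ℝ) ^ τ' ≤ u := by
      have h1 : (q : ℝ) ^ τ' = ((q : ℝ) ^ τ) ^ (τ' / τ) := by
        rw [← Real.rpow_mul hq0]; congr 1; field_simp
      rw [h1]
      calc ((q : ℝ) ^ τ) ^ (τ' / τ) ≤ (N : ℝ) ^ (τ' / τ) := Real.rpow_le_rpow hqτ0 hNτ.le hτ'τ0
        _ ≤ u := hNu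
    have hqM : (q : ℝ) ^ τ' ≤ (M : ℝ) := hqτ'.trans hMu
    -- the analytic input at `M`
    have hP : ∏ p ∈ Nat.primesBelow M, (1 - (χ p).re / p) ≤ A / ‖χ.LFunction 1‖ := by
      rw [hAdef]; exact hC q χ hχ1 τ' hτ'0 hτ'1 M hM8 hqM
    clear hC
    -- `‖L(1,χ)‖ ≤ A e⁵ log M ≤ A e⁵ log N`
    have hLup : ‖χ.LFunction 1‖ ≤ A * Real.exp 5 * Real.log N :=
      (norm_LFunction_one_le_of_prod_le χ hχ1 hM3 hP).trans
        (mul_le_mul_of_nonneg_left hlogMN (by positivity))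
    -- `log N ≤ 16 N^{1/16}`, `log⁴ N ≤ 16⁴ N^{1/4}`, `log² N ≤ 256 N^{1/8}`
    have hlog16 : Real.log N ≤ 16 * (N : ℝ) ^ ((1 : ℝ) / 16) := by
      have := Real.log_le_rpow_div hNpos.le (by norm_num : (0 : ℝ) < 1 / 16)
      linarith [show (N : ℝ) ^ ((1 : ℝ) / 16) / (1 / 16) = 16 * (N : ℝ) ^ ((1 : ℝ) / 16) by ring]
    have hN116 : 0 ≤ (N : ℝ) ^ ((1 : ℝ) / 16) := Real.rpow_nonneg hNpos.le _
    have hlog2 : Real.log N ^ 2 ≤ 256 * u := by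
      have h1 : Real.log N ^ 2 ≤ (16 * (N : ℝ) ^ ((1 : ℝ) / 16)) ^ 2 :=
        pow_le_pow_left₀ hlogN.le hlog16 2
      rw [mul_pow, hN16] at h1; norm_num at h1; exact h1
    have hlog4 : Real.log N ^ 4 ≤ 16 ^ 4 * u ^ 2 := by
      have h1 : Real.log N ^ 4 = (Real.log N ^ 2) ^ 2 := by ring
      rw [h1]
      calc (Real.log N ^ 2) ^ 2 ≤ (256 * u) ^ 2 := pow_le_pow_left₀ (by positivity) hlog2 2
        _ = 16 ^ 4 * u ^ 2 := by ring
    have hlogN1 : 1 ≤ Real.log N := by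
      have : Real.log (Real.exp 104) ≤ Real.log N := Real.log_le_log (Real.exp_pos _) hsmall
      rw [Real.log_exp] at this; linarith
    by_cases hq8 : q % 8 = 7
    · /- `d ≡ 1 (mod 8)`: all values even, `π ≤ 1 ≤ KB · T`. -/
      have hπ1 : (polyPrimeCount ![rabinowitschPoly d] N : ℝ) ≤ 1 := by
        exact_mod_cast polyPrimeCount_rabinowitsch_le_one hdq hq8 N
      have hstep : (1 : ℝ) ≤ KB * T := by
        refine key ?_
        rw [one_mul]
        calc ‖χ.LFunction 1‖ * Real.log N ≤ (A * Real.exp 5 * Real.log N) * Real.log N :=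
              mul_le_mul_of_nonneg_right hLup hlogN.le
          _ = A * Real.exp 5 * Real.log N ^ 2 := by ring
          _ ≤ A * Real.exp 5 * (256 * u) := mul_le_mul_of_nonneg_left hlog2 (by positivity)
          _ ≤ A * Real.exp 5 * (256 * N) := by gcongr
          _ = KB * N := by rw [hKB]; ring
      calc (polyPrimeCount ![rabinowitschPoly d] N : ℝ) ≤ 1 := hπ1
        _ ≤ KB * T := hstep
        _ ≤ (Ksmall + KB + Kmain + Kerr) * T := by
            refine mul_le_mul_of_nonneg_right ?_ hT0; linarith
    · /- `d ≡ 5 (mod 8)`: the sieve. -/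
      have hq83 : q % 8 = 3 := by omega
      obtain ⟨h2, hle⟩ := rabinowitsch_omega_hyps hdq hq83
      -- `π ≤ S + √M + 1`
      have hπS := rabinowitsch_polyPrimeCount_le hdq hq3 N (M : ℝ)
      -- `S ≤ (1 + Cω) N V(M) + M e⁸ log² M`
      have hM2R : (2 : ℝ) ≤ (M : ℝ) := by linarith
      have hx : ∀ n ∈ apIndex N 1 0, 0 < (rabinowitschPoly d).eval (n : ℤ) ∧
          (((rabinowitschPoly d).eval (n : ℤ) : ℤ) : ℝ) ≤ ((N : ℝ) + q + 1) ^ 2 := by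
        intro n hn
        rw [apIndex_one] at hn
        exact ⟨rabinowitsch_eval_pos hdq hq3 n, rabinowitsch_eval_le_sq hdq (Finset.mem_Ioc.mp hn).2⟩
      have hS := card_apIndex_coprime_le h2 hle (N := N) (r := 0) Nat.one_pos (z := (M : ℝ))
        (D := (M : ℝ)) hM2R le_rfl (fun p hp _ => hp.not_dvd_one) hx
      rw [apIndex_one, Nat.ceil_natCast, Nat.cast_one, div_one, ← hCωdef] at hS
      set V : ℝ := ∏ p ∈ Nat.primesBelow M, (1 - (polyRootCountMod ![rabinowitschPoly d] p : ℝ) / p)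
        with hVdef
      set S : ℝ := (#((Ioc 0 N).filter fun n : ℕ =>
          ((rabinowitschPoly d).eval (n : ℤ)).natAbs.Coprime (primesProdBelow (M : ℝ))) : ℝ) with hSdef
      have hV0 : 0 ≤ V := Finset.prod_nonneg fun p hp =>
        (one_sub_omega_div_pos hdq hq83 (Nat.prime_of_mem_primesBelow hp)).le
      -- `V ≤ e⁴ · 3/log(M-1) · A/‖L‖`
      have hVle : V ≤ (3 / Real.log ((M - 1 : ℕ) : ℝ)) * (A / ‖χ.LFunction 1‖) * Real.exp 4 := by
        have hpt : ∀ p ∈ Nat.primesBelow M,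
            (1 - (polyRootCountMod ![rabinowitschPoly d] p : ℝ) / p) ≤
              ((1 - 1 / (p : ℝ)) * (1 - (χ p).re / p)) * (1 + 4 / (p : ℝ) ^ 2) := by
          intro p hp
          have hpp := Nat.prime_of_mem_primesBelow hp
          have hp2 : (2 : ℝ) ≤ p := by exact_mod_cast hpp.two_le
          have hω : (polyRootCountMod ![rabinowitschPoly d] p : ℝ) = 1 + (χ p).re := by
            have h1 := polyRootCountMod_rabinowitschPoly hdq hq4 hpp
            have h2 := Literature.NumberTheory.LFunctions.PrimitiveQuadratic.apply_natCast_eq_jacobiSym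
              hqodd hqsq χ hprim hquad p
            have h3 : (χ p).re = (jacobiSym p q : ℝ) := by rw [h2, Complex.intCast_re]
            rw [h3]
            exact_mod_cast h1
          have hc : |(χ p).re| ≤ 1 := (Complex.abs_re_le_norm _).trans (DirichletCharacter.norm_le_one χ _)
          rw [hω]
          exact one_sub_one_add_div_le hp2 hc
        have hnn : ∀ p ∈ Nat.primesBelow M, 0 ≤ (1 - (polyRootCountMod ![rabinowitschPoly d] p : ℝ) / p) :=
          fun p hp => (one_sub_omega_div_pos hdq hq83 (Nat.prime_of_mem_primesBelow hp)).le
        have hprod := Finset.prod_le_prod hnn hpt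
        rw [Finset.prod_mul_distrib, Finset.prod_mul_distrib] at hprod
        -- the three factors
        have hF1 : ∏ p ∈ Nat.primesBelow M, (1 - 1 / (p : ℝ)) ≤ 3 / Real.log ((M - 1 : ℕ) : ℝ) := by
          rw [Nat.primesBelow_eq_primesLE_sub_one M]
          refine prod_primesLE_one_sub_inv_le ?_
          have hcast : ((M - 1 : ℕ) : ℝ) = (M : ℝ) - 1 := by rw [Nat.cast_sub hM1]; simp
          rw [hcast]
          exact le_trans (Real.exp_le_exp.mpr (by norm_num)) (hu13.trans huM)
        have hF1nn : 0 ≤ ∏ p ∈ Nat.primesBelow M, (1 - 1 / (p : ℝ)) := by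
          refine Finset.prod_nonneg fun p hp => ?_
          have hp1 : (1 : ℝ) ≤ p := by exact_mod_cast (Nat.prime_of_mem_primesBelow hp).one_lt.le
          rw [sub_nonneg, div_le_one (by linarith)]; exact hp1
        have hF2nn : 0 ≤ ∏ p ∈ Nat.primesBelow M, (1 - (χ p).re / p) := by
          refine Finset.prod_nonneg fun p hp => ?_
          have hp1 : (1 : ℝ) ≤ p := by exact_mod_cast (Nat.prime_of_mem_primesBelow hp).one_lt.le
          have hre : (χ p).re ≤ 1 := (Complex.re_le_norm _).trans (DirichletCharacter.norm_le_one χ _)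
          have : (χ p).re / p ≤ 1 / p := div_le_div_of_nonneg_right hre (by linarith)
          have : 1 / (p : ℝ) ≤ 1 := by rw [div_le_one (by linarith)]; exact hp1
          linarith
        have hF3nn : 0 ≤ ∏ p ∈ Nat.primesBelow M, (1 + 4 / (p : ℝ) ^ 2) :=
          Finset.prod_nonneg fun p _ => by positivity
        have hAL : 0 ≤ A / ‖χ.LFunction 1‖ := by positivity
        have hlog3 : 0 ≤ 3 / Real.log ((M - 1 : ℕ) : ℝ) := by
          refine div_nonneg (by norm_num) (Real.log_nonneg ?_)
          have hcast : ((M - 1 : ℕ) : ℝ) = (M : ℝ) - 1 := by rw [Nat.cast_sub hM1]; simp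
          rw [hcast]; linarith
        calc V ≤ (∏ p ∈ Nat.primesBelow M, (1 - 1 / (p : ℝ))) *
              (∏ p ∈ Nat.primesBelow M, (1 - (χ p).re / p)) *
              ∏ p ∈ Nat.primesBelow M, (1 + 4 / (p : ℝ) ^ 2) := hprod
          _ ≤ (3 / Real.log ((M - 1 : ℕ) : ℝ)) * (A / ‖χ.LFunction 1‖) * Real.exp 4 := by
              refine mul_le_mul (mul_le_mul hF1 hP hF2nn hlog3) (prod_one_add_four_div_sq_le M) hF3nn ?_
              positivity
      -- `1/log(M-1) ≤ 8/log N`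
      have hlogM1 : Real.log N / 8 ≤ Real.log ((M - 1 : ℕ) : ℝ) := by
        have hcast : ((M - 1 : ℕ) : ℝ) = (M : ℝ) - 1 := by rw [Nat.cast_sub hM1]; simp
        rw [hcast, ← hlogu]
        exact Real.log_le_log hu0 huM
      have hlogM1pos : 0 < Real.log ((M - 1 : ℕ) : ℝ) := lt_of_lt_of_le (by positivity) hlogM1
      -- MAIN TERM `(1 + Cω) N V ≤ Kmain T`
      have hmain : (1 + Cω) * (N : ℝ) * V ≤ Kmain * T := by
        have h3 : 3 / Real.log ((M - 1 : ℕ) : ℝ) ≤ 24 / Real.log N := by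
          rw [div_le_div_iff₀ hlogM1pos hlogN]; linarith
        calc (1 + Cω) * (N : ℝ) * V
            ≤ (1 + Cω) * (N : ℝ) * ((3 / Real.log ((M - 1 : ℕ) : ℝ)) * (A / ‖χ.LFunction 1‖) * Real.exp 4) :=
              mul_le_mul_of_nonneg_left hVle (by positivity)
          _ ≤ (1 + Cω) * (N : ℝ) * ((24 / Real.log N) * (A / ‖χ.LFunction 1‖) * Real.exp 4) := by
              refine mul_le_mul_of_nonneg_left ?_ (by positivity)
              refine mul_le_mul_of_nonneg_right (mul_le_mul_of_nonneg_right h3 (by positivity)) (by positivity)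
          _ = Kmain * T := by rw [hKmain, hT]; field_simp
      -- REMAINDER `M e⁸ log² M + √M + 1 ≤ Kerr T`
      have hsqrtM : Real.sqrt (M : ℝ) ≤ M := by
        have h1 : (M : ℝ) ≤ (M : ℝ) ^ 2 := by
          calc (M : ℝ) = M * 1 := (mul_one _).symm
            _ ≤ M * M := mul_le_mul_of_nonneg_left (by linarith) hM0.le
            _ = (M : ℝ) ^ 2 := (sq _).symm
        calc Real.sqrt (M : ℝ) ≤ Real.sqrt ((M : ℝ) ^ 2) := Real.sqrt_le_sqrt h1
          _ = M := Real.sqrt_sq hM0.le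
      have hlogM0 : 0 ≤ Real.log M := Real.log_nonneg (by linarith)
      have hErr : (M : ℝ) * (Real.exp 8 * Real.log (M : ℝ) ^ 2) + Real.sqrt (M : ℝ) + 1 ≤
          (Real.exp 8 + 2) * u ^ 2 * Real.log N ^ 2 := by
        have h1 : (M : ℝ) * (Real.exp 8 * Real.log (M : ℝ) ^ 2) ≤ u ^ 2 * (Real.exp 8 * Real.log N ^ 2) := by
          refine mul_le_mul hMle ?_ (by positivity) (by positivity)
          exact mul_le_mul_of_nonneg_left (pow_le_pow_left₀ hlogM0 hlogMN 2) (by positivity)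
        have hu4 : (2 : ℝ) ^ 2 ≤ u ^ 2 := pow_le_pow_left₀ (by norm_num) hu2 2
        have h2 : Real.sqrt (M : ℝ) + 1 ≤ 2 * u ^ 2 := by linarith [hsqrtM, hMle, hu4]
        have h3 : 2 * u ^ 2 ≤ 2 * u ^ 2 * Real.log N ^ 2 :=
          le_mul_of_one_le_right (by positivity) (one_le_pow₀ hlogN1)
        linarith [h1, h2, h3]
      have herr : (M : ℝ) * (Real.exp 8 * Real.log (M : ℝ) ^ 2) + Real.sqrt (M : ℝ) + 1 ≤ Kerr * T := by
        refine key ?_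
        calc ((M : ℝ) * (Real.exp 8 * Real.log (M : ℝ) ^ 2) + Real.sqrt (M : ℝ) + 1) *
              (‖χ.LFunction 1‖ * Real.log N)
            ≤ ((Real.exp 8 + 2) * u ^ 2 * Real.log N ^ 2) * ((A * Real.exp 5 * Real.log N) * Real.log N) := by
              refine mul_le_mul hErr (mul_le_mul_of_nonneg_right hLup hlogN.le) (by positivity) (by positivity)
          _ = (Real.exp 8 + 2) * (A * Real.exp 5) * u ^ 2 * Real.log N ^ 4 := by ring
          _ ≤ (Real.exp 8 + 2) * (A * Real.exp 5) * u ^ 2 * (16 ^ 4 * u ^ 2) :=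
              mul_le_mul_of_nonneg_left hlog4 (by positivity)
          _ = Kerr * u ^ 4 := by rw [hKerr]; ring
          _ ≤ Kerr * N := mul_le_mul_of_nonneg_left hu4N hKerr0
      -- assemble
      calc (polyPrimeCount ![rabinowitschPoly d] N : ℝ)
          ≤ S + Real.sqrt (M : ℝ) + 1 := hπS
        _ ≤ ((1 + Cω) * (N : ℝ) * V + (M : ℝ) * (Real.exp 8 * Real.log (M : ℝ) ^ 2)) +
              Real.sqrt (M : ℝ) + 1 := by linarith [hS]
        _ = (1 + Cω) * (N : ℝ) * V +
              ((M : ℝ) * (Real.exp 8 * Real.log (M : ℝ) ^ 2) + Real.sqrt (M : ℝ) + 1) := by ring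
        _ ≤ Kmain * T + Kerr * T := add_le_add hmain herr
        _ ≤ (Ksmall + KB + Kmain + Kerr) * T := by
            have e : (Ksmall + KB + Kmain + Kerr) * T = Ksmall * T + KB * T + Kmain * T + Kerr * T := by
              ring
            linarith [mul_nonneg hKsmall0 hT0, mul_nonneg hKB0 hT0]

end Literature.Barriers.Parity
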